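import Summits.Ventures.PercRepro.ProfilePointedCircuitClassesTwelveCocircuitA
import Summits.Ventures.PercRepro.ProfilePointedCircuitClassesFourteenQuad2
import Summits.Ventures.PercRepro.ProfilePointedCircuitClassesInOutTenE
import Summits.Ventures.PercRepro.ProfileGapMonoThresholdTopNullityPred

/-!
# PercRepro — A POINT OF A 3-COCIRCUIT, PART A: THE FOUR INJECTIONS INTO THE TEN-POINT MINORS (p5, gen 48;
`proofs/P5-GM1.md` §72)

On `#E = 12`, `ρ(E) = 7`, let `{e, p, q}` be a cocircuit (no two of the three a cocircuit).  A demand `W ∈ BI_5`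
through `e` contains at most one of `p, q` (its complement is a basis, which meets the cocircuit); the units
`S ∈ BI_6` avoiding `e` split by `S ∩ {p, q}`.  Writing `N₁ := N ／ e ∖ q`, `N₂ := N ／ p ∖ e` (ten points, rank 6):
`#{W ∋ e, p} = in_4^{N₁}(p) ≤ out_5^{N₁}(p) = #{S ∌ e, p : q ∈ S}` (the `n = 10` theorem, §59), symmetrically
with `p, q` swapped, and `#{W ∋ e : p, q ∉ W} = out_4^{N₂}(q)`, `#{S ∌ e : p, q ∈ S} = in_5^{N₂}(q)` — so the
twelve-point statement at `e` follows from the `n = 10` theorem together with `out_4(q) ≤ in_5(q)` on `N₂`, an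
instance of the per-point form of Theorem A at `n = 10` (the cell's `BiIndepPointed`, census-true, not proved).
This part proves the four injections (`W ↦ W − e` for the demands through `e, p`, resp. through `e` avoiding
`p, q`; `T ↦ T + q`, `T ↦ T + p` for the units); part B assembles them.
-/

open scoped Matroid

namespace PercRepro.Cogirth

open Finset ThmH Skew Shadow Profile

variable {α : Type} [DecidableEq α] {N : Matroid α} [N.Finite]

section ThreeCocircuitA

/-- The ground set of the minor `N ／ x ∖ w`. -/
theorem gr_minor_eq (x w : α) : gr ((N ／ ({x} : Set α)) ＼ ({w} : Set α)) = ((gr N).erase x).erase w := by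
  rw [gr_delete', gr_contract']

/-- The three hyperplane facts for the cocircuit `{e, p, q}`: for `X ⊆ E − {e, p, q}` each of `e, p, q` raises the
rank of `X` by one. -/
theorem hyperplane_facts_of_threeCocircuit {e p q : α} (he : e ∈ gr N) (hp : p ∈ gr N) (hq : q ∈ gr N)
    (hep : e ≠ p) (heq : e ≠ q) (hpq : p ≠ q) (hcoc : rk N ((((gr N).erase e).erase p).erase q) = 6)
    (hc1 : rk N (((gr N).erase e).erase p) = 7) (hc2 : rk N (((gr N).erase e).erase q) = 7)
    (hc3 : rk N (((gr N).erase p).erase q) = 7) {X : Finset α} (hX : X ⊆ (((gr N).erase e).erase p).erase q) :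
    rk N (insert e X) = rk N X + 1 ∧ rk N (insert p X) = rk N X + 1 ∧ rk N (insert q X) = rk N X + 1 :=
  rk_insert_eq_add_one_of_subset_cocircuit he hp hq hep.symm heq.symm hpq hcoc hc1 hc2 hc3 hX

omit [DecidableEq α] in
/-- `ρ(∅) = 0`. -/
theorem rk_empty_eq_zero : rk N (∅ : Finset α) = 0 :=
  Nat.le_zero.1 ((rk_le_card (M := N) ∅).trans (by rw [card_empty]))

/-- **THE DEMANDS THROUGH `e` AND `p` ARE THE DEMANDS OF `N ／ e ∖ q` THROUGH `p`** (an injection `W ↦ W − e`):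
for `W ∈ BI_5` with `e, p ∈ W`, `W − e ∈ BI_4(N ／ e ∖ q)` (`q ∉ W`, as `E ∖ W` is a basis meeting `{e, p, q}`). -/
theorem card_filter_demands_le_inCount_minor (hn : (gr N).card = 12) {e p q : α} (hq : q ∈ gr N) (hep : e ≠ p)
    (hH : ∀ X ⊆ (((gr N).erase e).erase p).erase q,
      rk N (insert e X) = rk N X + 1 ∧ rk N (insert p X) = rk N X + 1 ∧ rk N (insert q X) = rk N X + 1)
    (hcoc : rk N ((((gr N).erase e).erase p).erase q) = 6) :
    ((biIndepSets N 5).filter (fun W => e ∈ W ∧ p ∈ W)).card ≤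
      inCount ((N ／ ({e} : Set α)) ＼ ({q} : Set α)) 4 p := by
  have hre : rk N {e} = 1 := by
    have := (hH ∅ (empty_subset _)).1
    rw [insert_empty, rk_empty_eq_zero] at this
    exact this
  have hgr := gr_minor_eq (N := N) e q
  unfold inCount
  apply card_le_card_of_injOn (fun W => W.erase e)
  · intro W hW
    rw [mem_coe, mem_filter] at hW
    obtain ⟨hWb, heW, hpW⟩ := hW
    obtain ⟨hWg, hWc, hWr, hWcompl⟩ := mem_biIndepSets.1 hWb
    have hWr5 : rk N W = 5 := by rw [hWr, hWc]
    -- `q ∉ W`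
    have hqW : q ∉ W := by
      intro hqW
      have hsub : gr N \ W ⊆ (((gr N).erase e).erase p).erase q := by
        intro x hx
        rw [mem_sdiff] at hx
        exact mem_erase.2 ⟨fun h' => hx.2 (h' ▸ hqW), mem_erase.2 ⟨fun h' => hx.2 (h' ▸ hpW),
          mem_erase.2 ⟨fun h' => hx.2 (h' ▸ heW), hx.1⟩⟩⟩
      have h1 := rk_mono' (M := N) hsub
      have h2 : (gr N \ W).card = 7 := by rw [card_sdiff_of_subset hWg, hn, hWc]
      rw [hWcompl, h2, hcoc] at h1
      omega
    have hXg : W.erase e ⊆ gr ((N ／ ({e} : Set α)) ＼ ({q} : Set α)) := by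
      rw [hgr]
      intro x hx
      rw [mem_erase] at hx
      exact mem_erase.2 ⟨fun h' => hqW (h' ▸ hx.2), mem_erase.2 ⟨hx.1, hWg hx.2⟩⟩
    have hXc : (W.erase e).card = 4 := by rw [card_erase_of_mem heW, hWc]
    have hXr : rk ((N ／ ({e} : Set α)) ＼ ({q} : Set α)) (W.erase e) = 4 := by
      have := rk_minor_add_one hre hXg
      rw [insert_erase heW, hWr5] at this
      omega
    -- the complement `(E ∖ W) − q ⊆ E − {e, p, q}` is independent, and `e` raises its rank
    have hcompl : gr ((N ／ ({e} : Set α)) ＼ ({q} : Set α)) \ W.erase e = (gr N \ W).erase q := by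
      rw [hgr]
      ext x
      simp only [mem_sdiff, mem_erase, not_and]
      constructor
      · rintro ⟨⟨hxq, hxe, hxg⟩, hx⟩
        exact ⟨hxq, hxg, fun hxW => absurd (hx hxe) (fun h' => h' hxW)⟩
      · rintro ⟨hxq, hxg, hxW⟩
        exact ⟨⟨hxq, fun hxe => hxW (hxe ▸ heW), hxg⟩, fun _ => fun hxW' => absurd hxW' hxW⟩
    have hqc : q ∈ gr N \ W := mem_sdiff.2 ⟨hq, hqW⟩
    have hZH : (gr N \ W).erase q ⊆ (((gr N).erase e).erase p).erase q := by
      intro x hx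
      rw [mem_erase, mem_sdiff] at hx
      exact mem_erase.2 ⟨hx.1, mem_erase.2 ⟨fun h' => hx.2.2 (h' ▸ hpW), mem_erase.2 ⟨fun h' => hx.2.2 (h' ▸ heW),
        hx.2.1⟩⟩⟩
    have hZc : ((gr N \ W).erase q).card = 6 := by
      rw [card_erase_of_mem hqc, card_sdiff_of_subset hWg, hn, hWc]
    have hZr : rk N ((gr N \ W).erase q) = 6 := by
      rw [← hZc]
      exact rk_eq_card_of_subset_of_rk_eq_card (erase_subset _ _) hWcompl
    have hZg : (gr N \ W).erase q ⊆ gr ((N ／ ({e} : Set α)) ＼ ({q} : Set α)) := by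
      rw [hgr]
      intro x hx
      rw [mem_erase, mem_sdiff] at hx
      exact mem_erase.2 ⟨hx.1, mem_erase.2 ⟨fun h' => hx.2.2 (h' ▸ heW), hx.2.1⟩⟩
    have hZr' : rk ((N ／ ({e} : Set α)) ＼ ({q} : Set α)) ((gr N \ W).erase q) = 6 := by
      have := rk_minor_add_one hre hZg
      rw [(hH _ hZH).1, hZr] at this
      omega
    rw [mem_coe, mem_filter, mem_biIndepSets]
    refine ⟨⟨hXg, hXc, by rw [hXr, hXc], by rw [hcompl, hZr', hZc]⟩, mem_erase.2 ⟨hep.symm, hpW⟩⟩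
  · intro W₁ hW₁ W₂ hW₂ heq'
    rw [mem_coe, mem_filter] at hW₁ hW₂
    have h : W₁.erase e = W₂.erase e := heq'
    rw [← insert_erase hW₁.2.1, ← insert_erase hW₂.2.1, h]

/-- **THE UNITS OF `N ／ e ∖ q` AVOIDING `p` ARE UNITS THROUGH `q`** (an injection `T ↦ T + q`): for
`T ∈ BI_5(N ／ e ∖ q)` with `p ∉ T`, the set `T + q ∈ BI_6(N)` avoids `e, p` and contains `q` (`T ⊆ E − {e, p, q}`,
so `q` raises its rank; the complement `(E° ∖ T) + e` has rank `ρ°(E° ∖ T) + 1 = 6`). -/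
theorem outCount_minor_le_card_filter_units (hn : (gr N).card = 12) {e p q : α} (he : e ∈ gr N) (hq : q ∈ gr N)
    (heq : e ≠ q) (hpq : p ≠ q)
    (hH : ∀ X ⊆ (((gr N).erase e).erase p).erase q,
      rk N (insert e X) = rk N X + 1 ∧ rk N (insert p X) = rk N X + 1 ∧ rk N (insert q X) = rk N X + 1) :
    outCount ((N ／ ({e} : Set α)) ＼ ({q} : Set α)) 5 p ≤
      ((biIndepSets N 6).filter (fun S => (e ∉ S ∧ q ∈ S) ∧ p ∉ S)).card := by
  have hre : rk N {e} = 1 := by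
    have := (hH ∅ (empty_subset _)).1
    rw [insert_empty, rk_empty_eq_zero] at this
    exact this
  have hgr := gr_minor_eq (N := N) e q
  unfold outCount
  apply card_le_card_of_injOn (fun T => insert q T)
  · intro T hT
    rw [mem_coe, mem_filter] at hT
    obtain ⟨hTb, hpT⟩ := hT
    obtain ⟨hTg, hTc, hTr, hTcompl⟩ := mem_biIndepSets.1 hTb
    have hTg0 : T ⊆ ((gr N).erase e).erase q := by rw [← hgr]; exact hTg
    have hTH : T ⊆ (((gr N).erase e).erase p).erase q := by
      intro x hx
      have hx' := hTg0 hx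
      rw [mem_erase] at hx'
      exact mem_erase.2 ⟨hx'.1, mem_erase.2 ⟨fun h' => hpT (h' ▸ hx), hx'.2⟩⟩
    have hqT : q ∉ T := fun h' => (mem_erase.1 (hTg0 h')).1 rfl
    have heT : e ∉ T := fun h' => (mem_erase.1 (mem_erase.1 (hTg0 h')).2).1 rfl
    have hTr5 : rk N T = 5 := by
      have h1 := rk_minor_add_one hre hTg
      rw [(hH _ hTH).1, hTr, hTc] at h1
      omega
    have hSr : rk N (insert q T) = 6 := by rw [(hH _ hTH).2.2, hTr5]
    have hSc : (insert q T).card = 6 := by rw [card_insert_of_notMem hqT, hTc]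
    -- the complement `E ∖ (T + q) = (E° ∖ T) + e`, of rank `ρ°(E° ∖ T) + 1 = 6`
    have hcompl : gr N \ insert q T = insert e (gr ((N ／ ({e} : Set α)) ＼ ({q} : Set α)) \ T) := by
      rw [hgr]
      ext x
      simp only [mem_sdiff, mem_insert, mem_erase, not_or]
      constructor
      · rintro ⟨hxg, hxq, hxT⟩
        by_cases hxe : x = e
        · exact Or.inl hxe
        · exact Or.inr ⟨⟨hxq, hxe, hxg⟩, hxT⟩
      · rintro (rfl | ⟨⟨hxq, hxe, hxg⟩, hxT⟩)
        · exact ⟨he, heq, heT⟩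
        · exact ⟨hxg, hxq, hxT⟩
    have hZc : (gr ((N ／ ({e} : Set α)) ＼ ({q} : Set α)) \ T).card = 5 := by
      rw [card_sdiff_of_subset hTg, hgr, card_erase_of_mem (mem_erase.2 ⟨heq.symm, hq⟩), card_erase_of_mem he, hn, hTc]
    have heZ : e ∉ gr ((N ／ ({e} : Set α)) ＼ ({q} : Set α)) \ T := by
      rw [hgr]
      intro h'
      exact (mem_erase.1 (mem_erase.1 (mem_sdiff.1 h').1).2).1 rfl
    have hZr : rk N (insert e (gr ((N ／ ({e} : Set α)) ＼ ({q} : Set α)) \ T)) = 6 := by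
      have h1 := rk_minor_add_one hre
        (sdiff_subset : gr ((N ／ ({e} : Set α)) ＼ ({q} : Set α)) \ T ⊆ gr ((N ／ ({e} : Set α)) ＼ ({q} : Set α)))
      rw [hTcompl, hZc] at h1
      omega
    rw [mem_coe, mem_filter, mem_biIndepSets]
    refine ⟨⟨insert_subset hq (hTg0.trans ((erase_subset _ _).trans (erase_subset _ _))), hSc, by rw [hSr, hSc], ?_⟩,
      ⟨?_, mem_insert_self _ _⟩, ?_⟩
    · rw [hcompl, hZr, card_insert_of_notMem heZ, hZc]
    · rw [mem_insert, not_or]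
      exact ⟨heq, heT⟩
    · rw [mem_insert, not_or]
      exact ⟨hpq, hpT⟩
  · intro T₁ hT₁ T₂ hT₂ heq'
    rw [mem_coe, mem_filter] at hT₁ hT₂
    have h1 : q ∉ T₁ := fun h' => (mem_erase.1 ((hgr ▸ (mem_biIndepSets.1 hT₁.1).1) h')).1 rfl
    have h2 : q ∉ T₂ := fun h' => (mem_erase.1 ((hgr ▸ (mem_biIndepSets.1 hT₂.1).1) h')).1 rfl
    have h : insert q T₁ = insert q T₂ := heq'
    rw [← erase_insert h1, ← erase_insert h2, h]

/-- **THE DEMANDS THROUGH `e` AVOIDING `p, q` ARE THE OUT-SETS OF `N ／ p ∖ e` AT `q`** (an injection `W ↦ W − e`):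
for `W ∈ BI_5` with `e ∈ W`, `p, q ∉ W`, the set `W − e ⊆ E − {e, p, q}` lies in `BI_4(N ／ p ∖ e)` and avoids `q`
(`p` raises its rank; its complement `(E ∖ W) − p` has rank `ρ(E ∖ W) − 1 = 6` in the minor). -/
theorem card_filter_demands_free_le_outCount_minor (hn : (gr N).card = 12) {e p q : α} (hp : p ∈ gr N)
    (hH : ∀ X ⊆ (((gr N).erase e).erase p).erase q,
      rk N (insert e X) = rk N X + 1 ∧ rk N (insert p X) = rk N X + 1 ∧ rk N (insert q X) = rk N X + 1) :
    ((biIndepSets N 5).filter (fun W => e ∈ W ∧ p ∉ W ∧ q ∉ W)).card ≤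
      outCount ((N ／ ({p} : Set α)) ＼ ({e} : Set α)) 4 q := by
  have hrp : rk N {p} = 1 := by
    have := (hH ∅ (empty_subset _)).2.1
    rw [insert_empty, rk_empty_eq_zero] at this
    exact this
  have hgr := gr_minor_eq (N := N) p e
  unfold outCount
  apply card_le_card_of_injOn (fun W => W.erase e)
  · intro W hW
    rw [mem_coe, mem_filter] at hW
    obtain ⟨hWb, heW, hpW, hqW⟩ := hW
    obtain ⟨hWg, hWc, hWr, hWcompl⟩ := mem_biIndepSets.1 hWb
    have hXH : W.erase e ⊆ (((gr N).erase e).erase p).erase q := by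
      intro x hx
      rw [mem_erase] at hx
      exact mem_erase.2 ⟨fun h' => hqW (h' ▸ hx.2), mem_erase.2 ⟨fun h' => hpW (h' ▸ hx.2),
        mem_erase.2 ⟨hx.1, hWg hx.2⟩⟩⟩
    have hXg : W.erase e ⊆ gr ((N ／ ({p} : Set α)) ＼ ({e} : Set α)) := by
      rw [hgr]
      intro x hx
      rw [mem_erase] at hx
      exact mem_erase.2 ⟨hx.1, mem_erase.2 ⟨fun h' => hpW (h' ▸ hx.2), hWg hx.2⟩⟩
    have hXc : (W.erase e).card = 4 := by rw [card_erase_of_mem heW, hWc]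
    have hXr0 : rk N (W.erase e) = 4 := by
      rw [← hXc]
      exact rk_eq_card_of_subset_of_rk_eq_card (erase_subset _ _) hWr
    have hXr : rk ((N ／ ({p} : Set α)) ＼ ({e} : Set α)) (W.erase e) = 4 := by
      have := rk_minor_add_one hrp hXg
      rw [(hH _ hXH).2.1, hXr0] at this
      omega
    -- the complement `(E ∖ W) − p`; adding `p` back gives `E ∖ W`, of rank `7`
    have hcompl : gr ((N ／ ({p} : Set α)) ＼ ({e} : Set α)) \ W.erase e = (gr N \ W).erase p := by
      rw [hgr]
      ext x
      simp only [mem_sdiff, mem_erase, not_and]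
      constructor
      · rintro ⟨⟨hxe, hxp, hxg⟩, hx⟩
        exact ⟨hxp, hxg, fun hxW => absurd (hx hxe) (fun h' => h' hxW)⟩
      · rintro ⟨hxp, hxg, hxW⟩
        exact ⟨⟨fun hxe => hxW (hxe ▸ heW), hxp, hxg⟩, fun _ => fun hxW' => absurd hxW' hxW⟩
    have hpc : p ∈ gr N \ W := mem_sdiff.2 ⟨hp, hpW⟩
    have hZc : ((gr N \ W).erase p).card = 6 := by
      rw [card_erase_of_mem hpc, card_sdiff_of_subset hWg, hn, hWc]
    have hZg : (gr N \ W).erase p ⊆ gr ((N ／ ({p} : Set α)) ＼ ({e} : Set α)) := by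
      rw [hgr]
      intro x hx
      rw [mem_erase, mem_sdiff] at hx
      exact mem_erase.2 ⟨fun h' => hx.2.2 (h' ▸ heW), mem_erase.2 ⟨hx.1, hx.2.1⟩⟩
    have hZr' : rk ((N ／ ({p} : Set α)) ＼ ({e} : Set α)) ((gr N \ W).erase p) = 6 := by
      have := rk_minor_add_one hrp hZg
      rw [insert_erase hpc, hWcompl, card_sdiff_of_subset hWg, hn, hWc] at this
      omega
    rw [mem_coe, mem_filter, mem_biIndepSets]
    refine ⟨⟨hXg, hXc, by rw [hXr, hXc], by rw [hcompl, hZr', hZc]⟩, ?_⟩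
    rw [mem_erase, not_and]
    exact fun _ => hqW
  · intro W₁ hW₁ W₂ hW₂ heq'
    rw [mem_coe, mem_filter] at hW₁ hW₂
    have h : W₁.erase e = W₂.erase e := heq'
    rw [← insert_erase hW₁.2.1, ← insert_erase hW₂.2.1, h]

/-- **THE IN-SETS OF `N ／ p ∖ e` AT `q` ARE UNITS THROUGH `p` AND `q`** (an injection `T ↦ T + p`): for
`T ∈ BI_5(N ／ p ∖ e)` with `q ∈ T`, the set `T + p ∈ BI_6(N)` avoids `e` and contains `p, q` (its complement
`(E° ∖ T) + e` has `E° ∖ T ⊆ E − {e, p, q}`, so `e` raises the rank `ρ°(E° ∖ T) = 5` to `6`). -/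
theorem inCount_minor_le_card_filter_units_both (hn : (gr N).card = 12) {e p q : α} (he : e ∈ gr N) (hp : p ∈ gr N)
    (hep : e ≠ p)
    (hH : ∀ X ⊆ (((gr N).erase e).erase p).erase q,
      rk N (insert e X) = rk N X + 1 ∧ rk N (insert p X) = rk N X + 1 ∧ rk N (insert q X) = rk N X + 1) :
    inCount ((N ／ ({p} : Set α)) ＼ ({e} : Set α)) 5 q ≤
      ((biIndepSets N 6).filter (fun S => (e ∉ S ∧ p ∈ S) ∧ q ∈ S)).card := by
  have hrp : rk N {p} = 1 := by
    have := (hH ∅ (empty_subset _)).2.1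
    rw [insert_empty, rk_empty_eq_zero] at this
    exact this
  have hgr := gr_minor_eq (N := N) p e
  unfold inCount
  apply card_le_card_of_injOn (fun T => insert p T)
  · intro T hT
    rw [mem_coe, mem_filter] at hT
    obtain ⟨hTb, hqT⟩ := hT
    obtain ⟨hTg, hTc, hTr, hTcompl⟩ := mem_biIndepSets.1 hTb
    have hTg0 : T ⊆ ((gr N).erase p).erase e := by rw [← hgr]; exact hTg
    have heT : e ∉ T := fun h' => (mem_erase.1 (hTg0 h')).1 rfl
    have hpT : p ∉ T := fun h' => (mem_erase.1 (mem_erase.1 (hTg0 h')).2).1 rfl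
    have hSr : rk N (insert p T) = 6 := by
      have h1 := rk_minor_add_one hrp hTg
      rw [hTr, hTc] at h1
      omega
    have hSc : (insert p T).card = 6 := by rw [card_insert_of_notMem hpT, hTc]
    -- the complement `E ∖ (T + p) = (E° ∖ T) + e`
    have hcompl : gr N \ insert p T = insert e (gr ((N ／ ({p} : Set α)) ＼ ({e} : Set α)) \ T) := by
      rw [hgr]
      ext x
      simp only [mem_sdiff, mem_insert, mem_erase, not_or]
      constructor
      · rintro ⟨hxg, hxp, hxT⟩
        by_cases hxe : x = e
        · exact Or.inl hxe
        · exact Or.inr ⟨⟨hxe, hxp, hxg⟩, hxT⟩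
      · rintro (rfl | ⟨⟨hxe, hxp, hxg⟩, hxT⟩)
        · exact ⟨he, hep, heT⟩
        · exact ⟨hxg, hxp, hxT⟩
    have hZc : (gr ((N ／ ({p} : Set α)) ＼ ({e} : Set α)) \ T).card = 5 := by
      rw [card_sdiff_of_subset hTg, hgr, card_erase_of_mem (mem_erase.2 ⟨hep, he⟩), card_erase_of_mem hp, hn, hTc]
    have hZH : gr ((N ／ ({p} : Set α)) ＼ ({e} : Set α)) \ T ⊆ (((gr N).erase e).erase p).erase q := by
      rw [hgr]
      intro x hx
      rw [mem_sdiff, mem_erase, mem_erase] at hx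
      exact mem_erase.2 ⟨fun h' => hx.2 (h' ▸ hqT), mem_erase.2 ⟨hx.1.2.1, mem_erase.2 ⟨hx.1.1, hx.1.2.2⟩⟩⟩
    have heZ : e ∉ gr ((N ／ ({p} : Set α)) ＼ ({e} : Set α)) \ T := by
      rw [hgr]
      intro h'
      exact (mem_erase.1 (mem_sdiff.1 h').1).1 rfl
    have hZr0 : rk N (gr ((N ／ ({p} : Set α)) ＼ ({e} : Set α)) \ T) = 5 := by
      have h1 := rk_minor_add_one hrp
        (sdiff_subset : gr ((N ／ ({p} : Set α)) ＼ ({e} : Set α)) \ T ⊆ gr ((N ／ ({p} : Set α)) ＼ ({e} : Set α)))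
      rw [hTcompl, hZc, (hH _ hZH).2.1] at h1
      omega
    have hZr : rk N (insert e (gr ((N ／ ({p} : Set α)) ＼ ({e} : Set α)) \ T)) = 6 := by
      rw [(hH _ hZH).1, hZr0]
    rw [mem_coe, mem_filter, mem_biIndepSets]
    refine ⟨⟨insert_subset hp (hTg0.trans ((erase_subset _ _).trans (erase_subset _ _))), hSc, by rw [hSr, hSc], ?_⟩,
      ⟨?_, mem_insert_self _ _⟩, mem_insert_of_mem hqT⟩
    · rw [hcompl, hZr, card_insert_of_notMem heZ, hZc]
    · rw [mem_insert, not_or]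
      exact ⟨hep, heT⟩
  · intro T₁ hT₁ T₂ hT₂ heq'
    rw [mem_coe, mem_filter] at hT₁ hT₂
    have h1 : p ∉ T₁ := fun h' => (mem_erase.1 (mem_erase.1 ((hgr ▸ (mem_biIndepSets.1 hT₁.1).1) h')).2).1 rfl
    have h2 : p ∉ T₂ := fun h' => (mem_erase.1 (mem_erase.1 ((hgr ▸ (mem_biIndepSets.1 hT₂.1).1) h')).2).1 rfl
    have h : insert p T₁ = insert p T₂ := heq'
    rw [← erase_insert h1, ← erase_insert h2, h]

end ThreeCocircuitA

end PercRepro.Cogirth
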